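import Mathlib
import Summits.ValiantsHypothesis.ValiantsHypothesis.Theorems.LacunarySymmetroidMatrixDescartesInertiaCertificate
import Summits.ValiantsHypothesis.ValiantsHypothesis.Theorems.LacunarySymmetroidMatrixDescartesInertiaEndInertias

/-!
# Tower graft line — T3 structure: FIBRE REALITY — a far letter of inertia `(p, q)` has at least `|p − q|` real fibre roots,
# hence at most `2·min(p,q)` non-real ones (one negative square ⇒ ONE FREE PAIR)

Mechanism file for LINE (B) `Cruxes/WeakLifting/Lines/tower_graft.lean` (crux `WeakLifting` = stmt-ValiantsHypothesis-19561), memo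
`tower_graft-S5.md` §1 (Ed) / §3 T3 «fold budget» / §18.2 «remaining for T3: rank ≥ 3 mixed signature»; companion of this seat's located memo
`HOME/val-sym-lift-p2/g22/T3-RANK3-liftp2g22.md`.  NO stub is claimed.

THE THEOREM (`card_roots_fibre_ge_dist_inertia`).  `G`, `S` real symmetric, `S` non-singular with positive / negative indices `p`, `q`
(`p + q = m`).  Then the FIBRE polynomial `T ↦ det (T·S + G)` (degree exactly `m`, `natDegree_det_fibre`) has at least `|p − q|` real roots
counted with multiplicity; equivalently (`card_ι_le_card_roots_fibre_add`) its real-root DEFICIENCY `m − #{real roots with multiplicity}` — the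
number of non-real roots — is at most `2·min(p,q)`.  In particular a far letter with ONE negative square (`q = 1`: the staircase's indefinite
letters of signature `(r−1,1)`) has at most ONE non-real conjugate pair in every fibre `T ↦ det (G(t) + T·S)`: the folds counted by T3 are the
births and deaths of this single FREE PAIR along `t` (and `sign Disc_T = +1` iff the pair is real).
PROOF = INERTIA FLUX (the cell's inertia kit, `…InertiaCertificate` / `…InertiaEndInertias` / `…InertiaKit`): for `u > 0` small, `S + u·G` and
`−S + u·G` are non-singular with the inertias of `S` and `−S` (local constancy at a non-singular point, `Inertia.eventually_negIndex_eq`); with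
`T₀ = 1/u`, `G ± T₀·S = T₀·(±S + u·G)` has negative index `ν(S)` resp. `ν(−S) = π(S)` (`Inertia.negIndex_smul_pos`,
`Inertia.posIndex_eq_negIndex_neg`), and the one-gap inertia-walk certificate `Inertia.dist_negIndex_le_card_roots_gap` on `[−T₀, T₀]` for the
two-letter pencil `X⁰·G + X¹·S` gives `|ν(S) − π(S)| ≤ #{roots in (−T₀, T₀)}`.  This is the elementary form of the bound «an `H`-selfadjoint
matrix has at most `2·min(i₊(H), i₋(H))` non-real eigenvalues» [cite: Gohberg–Lancaster–Rodman, Indefinite Linear Algebra (2005), §5.2,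
inequality after (5.2.4)] — the roots of `det (T·S + G)` are minus the eigenvalues of the `S`-selfadjoint matrix `S⁻¹G`.
RANK-DEFICIENT LETTERS (§3): for `S = S₀ ⊕ 0` (`S₀` non-singular of indices `(p,q)`, `p + q =` rank) and `G = [[A,B],[Bᵀ,D]]` with `D`
non-singular — i.e. OFF the `(Er)` events of the memo, where the fibre degree drops — `det (X·S + G) = C(det D)·det (X·S₀ + Γ)`, `Γ` the Schur
complement (`det_fibre_fromBlocks_eq`, cleared by a constant block multiplier), so the fibre degree is the RANK and the flux bound `≥ |p − q|`
real roots holds verbatim (`card_roots_fibre_ge_dist_inertia_of_blocks`, `natDegree_det_fibre_fromBlocks`).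
HONEST FRAMING: structure of the fibres only — the NUMBER of folds along `t` is not bounded here (located: 10 > ζ(3,3) = 9 at (3,3), memo);
nothing on S4/S4b/S5, TowerB, `WeakLifting`, Conjecture B, `MatrixDescartes` (18050) or VP ≠ VNP.  Def-free; Mathlib + the inertia kit.
Seat: prover val-sym-lift-p2 g22, `--supports stmt-ValiantsHypothesis-19561 --as helper`.
-/

-- `Summit.ValiantsHypothesis.ValiantsHypothesis.…` repeats a component by the D-0017 layout
-- (single-conjunct summit), which the `dupNamespace` linter flags; the name is mandated.
set_option linter.dupNamespace false

namespace Summit.ValiantsHypothesis.ValiantsHypothesis.Theorems.KPlusLogSqLaw.TowerGraft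

open Polynomial Matrix Finset Filter
open scoped BigOperators Topology
open Summit.ValiantsHypothesis.ValiantsHypothesis.Theorems.LacunarySymmetroidMatrixDescartes
open Summit.ValiantsHypothesis.ValiantsHypothesis.Theorems.LacunarySymmetroidMatrixDescartes.Inertia

variable {ι : Type} [Fintype ι] [DecidableEq ι]

/-! ## §1 The fibre pencil `X⁰·G + X¹·S` as a two-letter lacunary pencil -/

section FibrePencil

omit [Fintype ι] [DecidableEq ι] in
/-- the two-letter pencil `(G, S)` on exponents `(0, 1)` evaluated at `x` is `G + x·S`. [folklore] -/
theorem fibre_pencil_eval (G S : Matrix ι ι ℝ) (x : ℝ) :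
    (∑ k : Fin 2, x ^ (![0, 1] : Fin 2 → ℕ) k • (![G, S] : Fin 2 → Matrix ι ι ℝ) k) = G + x • S := by
  rw [Fin.sum_univ_two]
  simp

omit [Fintype ι] [DecidableEq ι] in
/-- the two-letter pencil `(G, S)` on exponents `(0, 1)` is the polynomial matrix `X·S + G`. [folklore] -/
theorem fibre_pencil_poly (G S : Matrix ι ι ℝ) :
    (∑ k : Fin 2, (X : ℝ[X]) ^ (![0, 1] : Fin 2 → ℕ) k • ((![G, S] : Fin 2 → Matrix ι ι ℝ) k).map C) =
      (X : ℝ[X]) • S.map C + G.map C := by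
  rw [Fin.sum_univ_two, add_comm]
  simp

omit [Fintype ι] [DecidableEq ι] in
/-- symmetry of the two letters. [folklore] -/
theorem fibre_letters_isSymm {G S : Matrix ι ι ℝ} (hG : G.IsSymm) (hS : S.IsSymm) :
    ∀ k : Fin 2, ((![G, S] : Fin 2 → Matrix ι ι ℝ) k).IsSymm := by
  intro k
  fin_cases k
  · exact hG
  · exact hS

/-- **the fibre polynomial has degree exactly `m`** when `S` is non-singular (leading coefficient `det S`). [folklore] -/
theorem natDegree_det_fibre (G S : Matrix ι ι ℝ) (hSdet : S.det ≠ 0) :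
    ((X : ℝ[X]) • S.map C + G.map C).det.natDegree = Fintype.card ι := by
  refine le_antisymm (Polynomial.natDegree_det_X_add_C_le S G) ?_
  refine Polynomial.le_natDegree_of_ne_zero ?_
  rw [Polynomial.coeff_det_X_add_C_card]
  exact hSdet

/-- hence it is not the zero polynomial. [folklore] -/
theorem det_fibre_ne_zero (G S : Matrix ι ι ℝ) (hSdet : S.det ≠ 0) :
    ((X : ℝ[X]) • S.map C + G.map C).det ≠ 0 := by
  intro h
  have hcoeff := Polynomial.coeff_det_X_add_C_card S G
  rw [h, coeff_zero] at hcoeff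
  exact hSdet hcoeff.symm

end FibrePencil

/-! ## §2 Inertia flux: at least `|p − q|` real fibre roots -/

section Flux

omit [Fintype ι] [DecidableEq ι] in
/-- scaling out a large parameter: `G + T·S = T·(S + T⁻¹·G)` for `T ≠ 0`. [folklore] -/
theorem add_smul_eq_smul_add_inv_smul (G S : Matrix ι ι ℝ) {T : ℝ} (hT : T ≠ 0) :
    G + T • S = T • (S + T⁻¹ • G) := by
  rw [smul_add, smul_smul, mul_inv_cancel₀ hT, one_smul, add_comm]

omit [Fintype ι] [DecidableEq ι] in
/-- the mirror: `G + (−T)·S = T·(−S + T⁻¹·G)`. [folklore] -/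
theorem add_neg_smul_eq_smul_add_inv_smul (G S : Matrix ι ι ℝ) {T : ℝ} (hT : T ≠ 0) :
    G + (-T) • S = T • (-S + T⁻¹ • G) := by
  rw [smul_add, smul_smul, mul_inv_cancel₀ hT, one_smul, add_comm, smul_neg, neg_smul]

/-- **FIBRE REALITY (inertia flux).**  `G`, `S` real symmetric, `S` non-singular: the fibre polynomial `det (X·S + G)` has at least
`|π(S) − ν(S)|` real roots counted with multiplicity. [this work; the `H`-selfadjoint form is Gohberg–Lancaster–Rodman 2005 §5.2] -/
theorem card_roots_fibre_ge_dist_inertia (G S : Matrix ι ι ℝ) (hG : G.IsSymm) (hS : S.IsSymm) (hSdet : S.det ≠ 0) :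
    Nat.dist (Fintype.card {j // 0 < (isHermitian_of_isSymm hS).eigenvalues j})
        (Fintype.card {j // (isHermitian_of_isSymm hS).eigenvalues j < 0})
      ≤ Multiset.card ((X : ℝ[X]) • S.map C + G.map C).det.roots := by
  classical
  -- the two perturbation families at `u = 0`
  set A : ℝ → Matrix ι ι ℝ := fun u => S + u • G with hA
  set B : ℝ → Matrix ι ι ℝ := fun u => -S + u • G with hB
  have hAc : ∀ i j, Continuous fun u => A u i j := by
    intro i j
    simp only [hA, Matrix.add_apply, Matrix.smul_apply, smul_eq_mul]
    exact continuous_const.add (continuous_id.mul continuous_const)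
  have hBc : ∀ i j, Continuous fun u => B u i j := by
    intro i j
    simp only [hB, Matrix.add_apply, Matrix.smul_apply, Matrix.neg_apply, smul_eq_mul]
    exact continuous_const.add (continuous_id.mul continuous_const)
  have hAH : ∀ u, (A u).IsHermitian := fun u =>
    isHermitian_of_isSymm (by simp only [hA]; exact hS.add (hG.smul u))
  have hBH : ∀ u, (B u).IsHermitian := fun u =>
    isHermitian_of_isSymm (by simp only [hB]; exact hS.neg.add (hG.smul u))
  have hA0 : (A 0).det ≠ 0 := by simp only [hA, zero_smul, add_zero]; exact hSdet
  have hB0 : (B 0).det ≠ 0 := by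
    simp only [hB, zero_smul, add_zero, det_neg]
    exact mul_ne_zero (pow_ne_zero _ (by norm_num)) hSdet
  -- local constancy of the index and of non-singularity at `u = 0`
  have hdetA : ∀ᶠ u in 𝓝 (0 : ℝ), (A u).det ≠ 0 := by
    have hc : Continuous fun u => (A u).det := Continuous.matrix_det (continuous_pi fun i => continuous_pi fun j => hAc i j)
    exact hc.continuousAt.eventually_ne hA0
  have hdetB : ∀ᶠ u in 𝓝 (0 : ℝ), (B u).det ≠ 0 := by
    have hc : Continuous fun u => (B u).det := Continuous.matrix_det (continuous_pi fun i => continuous_pi fun j => hBc i j)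
    exact hc.continuousAt.eventually_ne hB0
  have hall := ((eventually_negIndex_eq A hAc hAH 0 hA0).and (eventually_negIndex_eq B hBc hBH 0 hB0)).and (hdetA.and hdetB)
  obtain ⟨ε, hε, hball⟩ := Metric.eventually_nhds_iff.mp hall
  set u : ℝ := ε / 2 with hu
  have hu0 : 0 < u := by rw [hu]; linarith
  have hudist : dist u 0 < ε := by
    rw [Real.dist_eq, sub_zero, abs_of_pos hu0, hu]; linarith
  obtain ⟨⟨hνA, hνB⟩, hAu, hBu⟩ := hball hudist
  -- the scales `±T₀`, `T₀ = 1/u`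
  set T₀ : ℝ := u⁻¹ with hT₀
  have hT₀0 : 0 < T₀ := inv_pos.mpr hu0
  have hT₀ne : T₀ ≠ 0 := hT₀0.ne'
  have hinv : T₀⁻¹ = u := by rw [hT₀, inv_inv]
  -- the pencil data
  set d : Fin 2 → ℕ := ![0, 1] with hd
  set L : Fin 2 → Matrix ι ι ℝ := ![G, S] with hL
  have hLs : ∀ k, (L k).IsSymm := fibre_letters_isSymm hG hS
  have hpoly : (∑ k, (X : ℝ[X]) ^ d k • (L k).map C) = (X : ℝ[X]) • S.map C + G.map C := fibre_pencil_poly G S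
  have hdet : Matrix.det (∑ k, ((X : ℝ[X]) ^ d k) • (L k).map C) ≠ 0 := by
    rw [hpoly]; exact det_fibre_ne_zero G S hSdet
  have hplus : (∑ k, T₀ ^ d k • L k) = T₀ • A u := by
    rw [fibre_pencil_eval, add_smul_eq_smul_add_inv_smul G S hT₀ne, hinv]
  have hminus : (∑ k, (-T₀) ^ d k • L k) = T₀ • B u := by
    rw [fibre_pencil_eval, add_neg_smul_eq_smul_add_inv_smul G S hT₀ne, hinv]
  have hb : (∑ k, T₀ ^ d k • L k).det ≠ 0 := by
    rw [hplus, det_smul]; exact mul_ne_zero (pow_ne_zero _ hT₀ne) hAu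
  have ha : (∑ k, (-T₀) ^ d k • L k).det ≠ 0 := by
    rw [hminus, det_smul]; exact mul_ne_zero (pow_ne_zero _ hT₀ne) hBu
  -- the one-gap certificate on `[−T₀, T₀]`
  have hgap := dist_negIndex_le_card_roots_gap d L hLs hdet (by linarith : -T₀ ≤ T₀) ha hb
  -- identify the end indices: `ν(F(T₀)) = ν(S)`, `ν(F(−T₀)) = ν(−S) = π(S)`
  have hXA : (T₀ • A u).IsHermitian := isHermitian_of_isSymm ((hS.add (hG.smul u)).smul T₀)
  have hXB : (T₀ • B u).IsHermitian := isHermitian_of_isSymm ((hS.neg.add (hG.smul u)).smul T₀)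
  have hνplus : Fintype.card {j // (isHermitian_pencil d L hLs T₀).eigenvalues j < 0} =
      Fintype.card {j // (isHermitian_of_isSymm hS).eigenvalues j < 0} := by
    rw [negIndex_congr (isHermitian_pencil d L hLs T₀) hXA hplus, negIndex_smul_pos (hAH u) hT₀0 hXA, hνA]
    exact negIndex_congr (hAH 0) _ (by simp only [hA, zero_smul, add_zero])
  have hνminus : Fintype.card {j // (isHermitian_pencil d L hLs (-T₀)).eigenvalues j < 0} =
      Fintype.card {j // 0 < (isHermitian_of_isSymm hS).eigenvalues j} := by
    rw [negIndex_congr (isHermitian_pencil d L hLs (-T₀)) hXB hminus, negIndex_smul_pos (hBH u) hT₀0 hXB, hνB,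
      posIndex_eq_negIndex_neg (isHermitian_of_isSymm hS) (isHermitian_of_isSymm hS).neg]
    exact negIndex_congr (hBH 0) _ (by simp only [hB, zero_smul, add_zero])
  rw [hνplus, hνminus, hpoly] at hgap
  rw [Nat.dist_comm]
  exact hgap.trans (Multiset.card_le_card (Multiset.filter_le _ _))

/-- **AT MOST `2·min(p,q)` NON-REAL FIBRE ROOTS.**  With `p = π(S)`, `q = ν(S)` (`p + q = m` as `S` is non-singular) the real-root deficiency of
the degree-`m` fibre polynomial is at most `2·min(p,q)`: `m ≤ #{real roots with multiplicity} + 2·min(p,q)`.  For `q = 1` (one negative square):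
at most ONE non-real conjugate pair — the FREE PAIR whose births and deaths are the folds of T3. [this work] -/
theorem card_ι_le_card_roots_fibre_add (G S : Matrix ι ι ℝ) (hG : G.IsSymm) (hS : S.IsSymm) (hSdet : S.det ≠ 0) :
    Fintype.card ι ≤ Multiset.card ((X : ℝ[X]) • S.map C + G.map C).det.roots +
      2 * min (Fintype.card {j // 0 < (isHermitian_of_isSymm hS).eigenvalues j})
        (Fintype.card {j // (isHermitian_of_isSymm hS).eigenvalues j < 0}) := by
  have h := card_roots_fibre_ge_dist_inertia G S hG hS hSdet
  have hsum := negIndex_add_posIndex_add_corank (isHermitian_of_isSymm hS)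
  rw [corank_eq_zero_of_det_ne_zero hSdet, add_zero] at hsum
  unfold Nat.dist at h
  rcases le_total (Fintype.card {j // 0 < (isHermitian_of_isSymm hS).eigenvalues j})
    (Fintype.card {j // (isHermitian_of_isSymm hS).eigenvalues j < 0}) with hle | hle
  · rw [min_eq_left hle]; omega
  · rw [min_eq_right hle]; omega

/-- the same deficiency read against the degree: `natDegree − #{real roots} ≤ 2·min(p,q)`. [this work] -/
theorem natDegree_sub_card_roots_fibre_le (G S : Matrix ι ι ℝ) (hG : G.IsSymm) (hS : S.IsSymm) (hSdet : S.det ≠ 0) :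
    ((X : ℝ[X]) • S.map C + G.map C).det.natDegree - Multiset.card ((X : ℝ[X]) • S.map C + G.map C).det.roots ≤
      2 * min (Fintype.card {j // 0 < (isHermitian_of_isSymm hS).eigenvalues j})
        (Fintype.card {j // (isHermitian_of_isSymm hS).eigenvalues j < 0}) := by
  rw [natDegree_det_fibre G S hSdet]
  have := card_ι_le_card_roots_fibre_add G S hG hS hSdet
  omega

end Flux

/-! ## §3 Rank-deficient far letters: the fibre degree is the rank, and the flux bound holds for the Schur complement -/

section Singular

variable {α β : Type} [Fintype α] [DecidableEq α] [Fintype β] [DecidableEq β]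

/-- **Schur reduction of the fibre polynomial.**  For a far letter in normal form `S₀ ⊕ 0` (`S₀ : α × α`) and `G = [[A, B], [Bᵀ, D]]` with the
complementary block `D` NON-SINGULAR, `det (X·(S₀ ⊕ 0) + G) = C(det D) · det (X·S₀ + Γ)` with the Schur complement `Γ = A − B D⁻¹ Bᵀ`
(cleared by the constant block multiplier `[[1, 0], [−D⁻¹Bᵀ, 1]]`, no inversion in `ℝ[X]`). [folklore] -/
theorem det_fibre_fromBlocks_eq (A S₀ : Matrix α α ℝ) (B : Matrix α β ℝ) (D : Matrix β β ℝ) (hDdet : D.det ≠ 0) :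
    ((X : ℝ[X]) • (fromBlocks S₀ 0 0 (0 : Matrix β β ℝ)).map C + (fromBlocks A B Bᵀ D).map C).det =
      C D.det * ((X : ℝ[X]) • S₀.map C + (A - B * D⁻¹ * Bᵀ).map C).det := by
  have hDD : D * D⁻¹ = 1 := Matrix.mul_nonsing_inv D (isUnit_iff_ne_zero.mpr hDdet)
  have hM : (X : ℝ[X]) • (fromBlocks S₀ 0 0 (0 : Matrix β β ℝ)).map C + (fromBlocks A B Bᵀ D).map C =
      fromBlocks ((X : ℝ[X]) • S₀.map C + A.map C) (B.map C) (Bᵀ.map C) (D.map C) := by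
    rw [fromBlocks_map, fromBlocks_map, fromBlocks_smul, fromBlocks_add]
    simp [Matrix.map_zero C C_0]
  have hP : (fromBlocks ((X : ℝ[X]) • S₀.map C + A.map C) (B.map C) (Bᵀ.map C) (D.map C)) *
      fromBlocks 1 0 (-(D⁻¹ * Bᵀ).map C) 1 =
      fromBlocks ((X : ℝ[X]) • S₀.map C + (A - B * D⁻¹ * Bᵀ).map C) (B.map C) 0 (D.map C) := by
    rw [fromBlocks_multiply]
    simp only [Matrix.mul_one, Matrix.mul_zero, zero_add, Matrix.mul_neg]
    congr 1
    · rw [← Matrix.map_mul, Matrix.map_sub C (map_sub C), ← sub_eq_add_neg, Matrix.map_mul, Matrix.map_mul, Matrix.map_mul,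
        ← Matrix.mul_assoc, add_sub_assoc, Matrix.map_mul]
    · rw [← Matrix.map_mul, ← Matrix.mul_assoc, hDD, Matrix.one_mul, add_neg_cancel]
  have hdetP : (fromBlocks (1 : Matrix α α ℝ[X]) 0 (-(D⁻¹ * Bᵀ).map C) 1).det = 1 := by
    rw [det_fromBlocks_zero₁₂, det_one, det_one, mul_one]
  have h := congrArg Matrix.det hP
  rw [det_mul, hdetP, mul_one, det_fromBlocks_zero₂₁] at h
  have hDmap : (D.map C).det = C D.det := by rw [RingHom.map_det, RingHom.mapMatrix_apply]
  rw [hM, h, hDmap, mul_comm]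

omit [Fintype α] [DecidableEq α] in
/-- the Schur complement of a symmetric block matrix with symmetric non-singular corner is symmetric. [folklore] -/
theorem isSymm_schur (A : Matrix α α ℝ) (B : Matrix α β ℝ) (D : Matrix β β ℝ) (hA : A.IsSymm) (hD : D.IsSymm) :
    (A - B * D⁻¹ * Bᵀ).IsSymm := by
  have hDi : (D⁻¹)ᵀ = D⁻¹ := by rw [Matrix.transpose_nonsing_inv, hD.eq]
  rw [Matrix.IsSymm, Matrix.transpose_sub, hA.eq, Matrix.transpose_mul, Matrix.transpose_mul, Matrix.transpose_transpose, hDi,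
    Matrix.mul_assoc]

/-- **FIBRE REALITY FOR A RANK-DEFICIENT FAR LETTER.**  Far letter `S₀ ⊕ 0` with `S₀` non-singular of indices `(p, q)` (`p + q = |α| =` the
rank), `G = [[A, B], [Bᵀ, D]]` symmetric with the complementary block `D` non-singular (i.e. off the `(Er)` events of the memo): the fibre
polynomial `det (X·(S₀ ⊕ 0) + G)` has at least `|p − q|` real roots with multiplicity — inertia flux for the Schur complement. [this work] -/
theorem card_roots_fibre_ge_dist_inertia_of_blocks (A S₀ : Matrix α α ℝ) (B : Matrix α β ℝ) (D : Matrix β β ℝ)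
    (hA : A.IsSymm) (hD : D.IsSymm) (hS₀ : S₀.IsSymm) (hDdet : D.det ≠ 0) (hS₀det : S₀.det ≠ 0) :
    Nat.dist (Fintype.card {j // 0 < (isHermitian_of_isSymm hS₀).eigenvalues j})
        (Fintype.card {j // (isHermitian_of_isSymm hS₀).eigenvalues j < 0})
      ≤ Multiset.card ((X : ℝ[X]) • (fromBlocks S₀ 0 0 (0 : Matrix β β ℝ)).map C + (fromBlocks A B Bᵀ D).map C).det.roots := by
  rw [det_fibre_fromBlocks_eq A S₀ B D hDdet, Polynomial.roots_C_mul _ hDdet]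
  exact card_roots_fibre_ge_dist_inertia _ S₀ (isSymm_schur A B D hA hD) hS₀ hS₀det

/-- and its degree is exactly the RANK `|α|` of the far letter (off the `(Er)` events). [this work] -/
theorem natDegree_det_fibre_fromBlocks (A S₀ : Matrix α α ℝ) (B : Matrix α β ℝ) (D : Matrix β β ℝ)
    (hDdet : D.det ≠ 0) (hS₀det : S₀.det ≠ 0) :
    ((X : ℝ[X]) • (fromBlocks S₀ 0 0 (0 : Matrix β β ℝ)).map C + (fromBlocks A B Bᵀ D).map C).det.natDegree = Fintype.card α := by
  rw [det_fibre_fromBlocks_eq A S₀ B D hDdet, Polynomial.natDegree_C_mul hDdet, natDegree_det_fibre _ S₀ hS₀det]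

end Singular

end Summit.ValiantsHypothesis.ValiantsHypothesis.Theorems.KPlusLogSqLaw.TowerGraft
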